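import Summits.CriticalPhenomena.Ising3D.Control2DBoxCells
import Summits.CriticalPhenomena.Ising3D.Control2DOpeTwoSided
import Summits.CriticalPhenomena.Ising3D.Control2DTaylorSound
import Summits.CriticalPhenomena.Ising3D.Control2DRegionKernel
import Summits.CriticalPhenomena.Ising3D.Control2DKernelCell
import Mathlib.Analysis.SpecificLimits.Basic
import Mathlib.Data.Nat.Choose.Vandermonde
import Mathlib.Tactic.Linarith
import Mathlib.Tactic.Positivity
import Mathlib.Tactic.FieldSimp
import Mathlib.Tactic.Ring
import Mathlib.Tactic.GCongr
import HarnessLib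

/-!
# Kind `ope2`, sense LOWER: an explicit tail majorant for the stress-tensor block under the table functional at `(1/2,1/2)`
(cell `pub-ising3x`, seat controls-1 gen 21; KERNEL PATH for the 2D γ-certificates, kind `ope2`, sense lower — CONTROL-ONLY)

HONEST FRAMING: lottery ticket; floor = tightest certified 3D Ising CFT bounds; no exact-solution
claim without a proof. CONTROL-ONLY (`d = 2`, axiom set `A2D′`); nothing numerical is asserted here.

`Control2DOpeCells` (controls-1 g20) put the UPPER sense of the lane's `c` datum on the kernel path (`phi_QN_le_block_taylor`: the
truncated `(2,2)` block under-estimates the full one). The LOWER sense (`OpeLowerA2D`, `P < p_T`, the `c` UPPER edge) needs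
`φ[F_-[g_{2,2}]] < 0`, hence a MAJORANT of the dropped `z`-series tail. For `φ = taylorFunctional2D (1/2) S w` (`0 ≤ s ≤ 1`, table
indices `≤ Λ` in each coordinate, `0 < N`, `Λ < N + 3`), with `W = Σ_{p∈S} |w_p| c_p`, `c_p = (1-(-1)^{p₁+p₂}) 2^{p₁+p₂}`:
  `φ[F_-[g_{2,2}]] ≤ φ[F_-[Q_N(2,2)]] + (1/2)^{2s} · 2W · 2^{-(N+2)} C(N+2+Λ, Λ) · 2(N+3)/(N+3-Λ)`   (`phi_block22_le_QN_add_tail`).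
Ingredients, all elementary: the `h̄ = 0` chiral factor of `g_{2,2}` is trivial (`a_{m'}(0) = [m' = 0]`), so the block series is the single
`z`-series `Σ_m a_m(2) φ[F_-[pairPow (m+2) 0]]`; `a_m(2) ≤ 1`; the pair-monomial value at `(1/2,1/2)` (`Control2DTaylorHalf`) with
`|q_0(k)| = |C(s,k)| ≤ 1` and `|q_α(k)| ≤ C(α+k, k)` for `α ∈ ℕ` (Vandermonde); geometric decrease of `2^{-n} C(n+Λ, Λ)` with ratio
`≤ (N+3+Λ)/(2(N+3)) < 1`. Consequence `opeLower_half_of_cellsN`: the kind-`ope2` cells record `OpeCellsN` (the box kind's WITHOUT the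
stress-tensor row) + (R) + (I′) on the truncated block + the sign check `φ[F_-[Q_N(2,2)]] + majorant < 0` give `OpeLowerA2D`
(`OpeA2DObligations.opeLower_taylor`); the integer form a replay decides is in `Control2DOpeTailKernel`. The readers of record
(`verify_A2d.py` 2.4 / `verify_B2d.py` 2.3, RB6/README §1) use their own geometric-ratio majorants of the same series; this one is coarser and
needs more levels (Λ = 19: `N ≥ 96`), which costs nothing for a scalar. PROVED; no facts, standard axioms only. [cite: RattazziEtAl2008, §5]
-/

namespace Summit.CriticalPhenomena.Ising3D.Control2D

open Finset Set
open Literature.MathematicalPhysics.QuantumFieldTheory.ConformalBootstrap3D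

/-! ### Three elementary bounds -/

/-- `a_m(2) ≤ 1`: every factor `(2+i)²/((i+1)(4+i))` of the product form is `≤ 1` (and the first is `2/2`). [folklore] -/
theorem chiralCoeff_two_le_one (m : ℕ) : chiralCoeff 2 m ≤ 1 := by
  rw [chiralCoeff_eq_prod (by norm_num : (0 : ℝ) ≤ 2)]
  unfold chiralProd
  refine Finset.prod_le_one (fun i _ => chiralFactor_nonneg i (by norm_num)) fun i _ => ?_
  unfold chiralFactor
  split_ifs with hi
  · norm_num
  · have hi0 : (0 : ℝ) ≤ i := Nat.cast_nonneg i
    rw [div_le_one (by positivity)]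
    nlinarith

/-- `|C(s, i)| ≤ 1` for `0 ≤ s ≤ 1` (`|s(s-1)⋯(s-i+1)| ≤ i!`). [folklore] -/
theorem abs_ring_choose_le_one {s : ℝ} (hs0 : 0 ≤ s) (hs1 : s ≤ 1) (i : ℕ) : |Ring.choose s i| ≤ 1 := by
  have hD : ∀ n : ℕ, |(descPochhammer ℝ n).eval s| ≤ (n.factorial : ℝ) := by
    intro n
    induction n with
    | zero => simp
    | succ n ih =>
        rw [descPochhammer_succ_eval, abs_mul, Nat.factorial_succ, Nat.cast_mul, mul_comm ((n + 1 : ℕ) : ℝ)]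
        refine mul_le_mul ih ?_ (abs_nonneg _) (Nat.cast_nonneg _)
        rw [abs_le]; push_cast; constructor <;> linarith
  rw [choose_eq_descPochhammer_div, abs_div, abs_of_pos (by positivity : (0 : ℝ) < i.factorial),
    div_le_one (by positivity)]
  exact hD i

/-- `|q¹(s, α; k)| ≤ C(α+k, k)` for a natural `α` and `0 ≤ s ≤ 1`
(`|q| ≤ Σ_{i+i'=k} |C(s,i)| C(α,i') ≤ Σ_{i'≤k} C(α,i') ≤ Σ_{i+i'=k} C(k,i) C(α,i') = C(k+α, k)`, Vandermonde). [folklore] -/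
theorem abs_qFactor₁_natCast_le {s : ℝ} (hs0 : 0 ≤ s) (hs1 : s ≤ 1) (α k : ℕ) :
    |qFactor₁ s (α : ℝ) k| ≤ ((α + k).choose k : ℝ) := by
  unfold qFactor₁
  refine (Finset.abs_sum_le_sum_abs _ _).trans ?_
  have hV : ((α + k).choose k : ℝ) = ∑ ij ∈ antidiagonal k, ((k.choose ij.1 : ℕ) : ℝ) * ((α.choose ij.2 : ℕ) : ℝ) := by
    rw [add_comm, Nat.add_choose_eq]
    push_cast
    rfl
  rw [hV]
  refine Finset.sum_le_sum fun ij hij => ?_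
  have hi : ij.1 ≤ k := by have := mem_antidiagonal.mp hij; omega
  rw [abs_mul, abs_mul, abs_pow, abs_neg, abs_one, one_pow, one_mul, Ring.choose_natCast,
    Nat.abs_cast]
  refine mul_le_mul ?_ le_rfl (Nat.cast_nonneg _) (Nat.cast_nonneg _)
  have h1 : (1 : ℝ) ≤ ((k.choose ij.1 : ℕ) : ℝ) := by exact_mod_cast Nat.choose_pos hi
  exact (abs_ring_choose_le_one hs0 hs1 _).trans h1

/-! ### The table functional on one pair monomial of the stress-tensor series -/

/-- The parity weight is `0` or `2^{p₁+p₂+1}`, in particular `≥ 0`. [folklore] -/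
theorem cfac_nonneg (p : ℕ × ℕ) : 0 ≤ cfac p := by
  unfold cfac; refine mul_nonneg ?_ (by positivity)
  rcases neg_one_pow_eq_or ℝ (p.1 + p.2) with h | h <;> rw [h] <;> norm_num

/-- The absolute weight `W = Σ_{p∈S} |w_p| c_p` of a table. [folklore] -/
noncomputable def absWeight (S : Finset (ℕ × ℕ)) (w : ℕ × ℕ → ℝ) : ℝ := ∑ p ∈ S, |w p| * cfac p

/-- [folklore] -/
theorem absWeight_nonneg (S : Finset (ℕ × ℕ)) (w : ℕ × ℕ → ℝ) : 0 ≤ absWeight S w :=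
  Finset.sum_nonneg fun p _ => mul_nonneg (abs_nonneg _) (cfac_nonneg p)

/-- **The table functional on `F_-[x^n + y^n]`** (the `m = n - 2` term of the stress-tensor series), bounded by the absolute
weight: `|φ[F_-[pairPow n 0]]| ≤ (1/2)^{2s} 2^{-n} · 2 C(n+Λ, Λ) · W` when every table index is `≤ Λ` in each coordinate.
[folklore] -/
theorem abs_taylorFunctional2D_half_pairPow_le (S : Finset (ℕ × ℕ)) (w : ℕ × ℕ → ℝ) {s : ℝ} (hs0 : 0 ≤ s)
    (hs1 : s ≤ 1) {Λ : ℕ} (hΛ : ∀ p ∈ S, p.1 ≤ Λ ∧ p.2 ≤ Λ) (n : ℕ) :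
    |taylorFunctional2D (1 / 2) S w (crossF s (-1) (pairPow ((0 : ℝ) + n) 0))| ≤
      (1 / 2 : ℝ) ^ s * (1 / 2 : ℝ) ^ s * (1 / 2 : ℝ) ^ n * (2 * ((n + Λ).choose Λ : ℝ) * absWeight S w) := by
  rw [taylorFunctional2D_half_crossF_pairPow S w s le_rfl n]
  have hpow : (1 / 2 : ℝ) ^ ((0 : ℝ) + n) = (1 / 2 : ℝ) ^ n := by rw [zero_add, Real.rpow_natCast]
  rw [hpow, Real.rpow_zero, mul_one, abs_mul]
  have hC0 : 0 ≤ (1 / 2 : ℝ) ^ s * (1 / 2 : ℝ) ^ s * (1 / 2 : ℝ) ^ n := by positivity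
  rw [abs_of_nonneg hC0]
  refine mul_le_mul_of_nonneg_left ?_ hC0
  refine (Finset.abs_sum_le_sum_abs _ _).trans ?_
  rw [absWeight, Finset.mul_sum]
  refine Finset.sum_le_sum fun p hp => ?_
  obtain ⟨h1, h2⟩ := hΛ p hp
  -- the binomial polynomials at a natural argument and at `0`
  have hq0 : ∀ k : ℕ, |qFactor₁ s 0 k| ≤ 1 := by
    intro k
    rw [qFactor₁_zero_right, abs_mul, abs_pow, abs_neg, abs_one, one_pow, one_mul]
    exact abs_ring_choose_le_one hs0 hs1 k
  have hqn : ∀ k : ℕ, k ≤ Λ → |qFactor₁ s ((0 : ℝ) + n) k| ≤ ((n + Λ).choose Λ : ℝ) := by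
    intro k hk
    rw [zero_add]
    refine (abs_qFactor₁_natCast_le hs0 hs1 n k).trans ?_
    have hkk : (n + k).choose k = (n + k).choose n := by rw [add_comm, Nat.choose_symm_add]
    have hΛΛ : (n + Λ).choose Λ = (n + Λ).choose n := by rw [add_comm, Nat.choose_symm_add]
    rw [hkk, hΛΛ]
    exact_mod_cast Nat.choose_le_choose n (by omega)
  have hbr : |qFactor₁ s ((0 : ℝ) + n) p.1 * qFactor₁ s 0 p.2 + qFactor₁ s 0 p.1 * qFactor₁ s ((0 : ℝ) + n) p.2| ≤
      2 * ((n + Λ).choose Λ : ℝ) := by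
    refine (abs_add_le _ _).trans ?_
    rw [abs_mul, abs_mul, two_mul]; refine add_le_add ?_ ?_
    · exact (mul_le_mul (hqn p.1 h1) (hq0 p.2) (abs_nonneg _) (Nat.cast_nonneg _)).trans_eq (mul_one _)
    · exact (mul_le_mul (hq0 p.1) (hqn p.2 h2) (abs_nonneg _) zero_le_one).trans_eq (one_mul _)
  rw [abs_mul, abs_mul, show |(1 - (-1 : ℝ) ^ (p.1 + p.2)) * 2 ^ (p.1 + p.2)| = cfac p from abs_of_nonneg (cfac_nonneg p)]
  calc |w p| * (cfac p * |qFactor₁ s ((0 : ℝ) + n) p.1 * qFactor₁ s 0 p.2 + qFactor₁ s 0 p.1 * qFactor₁ s ((0 : ℝ) + n) p.2|)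
      ≤ |w p| * (cfac p * (2 * ((n + Λ).choose Λ : ℝ))) :=
        mul_le_mul_of_nonneg_left (mul_le_mul_of_nonneg_left hbr (cfac_nonneg p)) (abs_nonneg _)
    _ = 2 * ((n + Λ).choose Λ : ℝ) * (|w p| * cfac p) := by ring

/-! ### A geometric tail -/

/-- **Geometric domination**: `0 ≤ t`, `t_{j+1} ≤ r t_j` with `0 ≤ r < 1` ⇒ `t` summable and `Σ_j t_j ≤ t_0/(1-r)`. [folklore] -/
theorem tsum_le_of_ratio_le {t : ℕ → ℝ} {r : ℝ} (hr0 : 0 ≤ r) (hr1 : r < 1) (ht0 : ∀ j, 0 ≤ t j)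
    (ht : ∀ j, t (j + 1) ≤ r * t j) : Summable t ∧ ∑' j, t j ≤ t 0 / (1 - r) := by
  have hle : ∀ j, t j ≤ t 0 * r ^ j := by
    intro j
    induction j with
    | zero => simp
    | succ j ih =>
        calc t (j + 1) ≤ r * t j := ht j
          _ ≤ r * (t 0 * r ^ j) := mul_le_mul_of_nonneg_left ih hr0
          _ = t 0 * r ^ (j + 1) := by ring
  have hg : Summable fun j => t 0 * r ^ j := (summable_geometric_of_lt_one hr0 hr1).mul_left (t 0)
  have hs : Summable t := Summable.of_nonneg_of_le ht0 hle hg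
  refine ⟨hs, ?_⟩
  calc ∑' j, t j ≤ ∑' j, t 0 * r ^ j := Summable.tsum_le_tsum hle hs hg
    _ = t 0 * (1 - r)⁻¹ := by rw [tsum_mul_left, tsum_geometric_of_lt_one hr0 hr1]
    _ = t 0 / (1 - r) := by rw [div_eq_mul_inv]

/-- The explicit tail majorant after the terms `n < M` of `Σ_n 2^{-n} C(n+Λ, Λ)`:
`2^{-M} C(M+Λ, Λ) · 2(M+1)/(M+1-Λ)` (meaningful for `Λ < M + 1`). [folklore] -/
noncomputable def tailMajor (Λ M : ℕ) : ℝ :=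
  (1 / 2 : ℝ) ^ M * ((M + Λ).choose Λ : ℝ) * ((2 * ((M : ℝ) + 1)) / ((M : ℝ) + 1 - Λ))

/-- **The geometric tail of the stress-tensor majorant**: for `Λ < M + 1` the terms `t_j = 2^{-(M+j)} C(M+j+Λ, Λ)` have ratio
`t_{j+1}/t_j = (M+j+1+Λ)/(2(M+j+1)) ≤ (M+1+Λ)/(2(M+1)) < 1`, hence `Σ_j t_j ≤ tailMajor Λ M`. [folklore] -/
theorem tsum_tail_le_tailMajor {Λ M : ℕ} (hΛ : Λ < M + 1) :
    Summable (fun j : ℕ => (1 / 2 : ℝ) ^ (j + M) * ((j + M + Λ).choose Λ : ℝ)) ∧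
      ∑' j : ℕ, (1 / 2 : ℝ) ^ (j + M) * ((j + M + Λ).choose Λ : ℝ) ≤ tailMajor Λ M := by
  set r : ℝ := ((M : ℝ) + 1 + Λ) / (2 * ((M : ℝ) + 1)) with hr
  have hM1 : (0 : ℝ) < (M : ℝ) + 1 := by positivity
  have hΛR : (Λ : ℝ) < (M : ℝ) + 1 := by exact_mod_cast hΛ
  have hr0 : 0 ≤ r := by rw [hr]; positivity
  have hr1 : r < 1 := by rw [hr, div_lt_one (by positivity)]; linarith
  have ht0 : ∀ j : ℕ, 0 ≤ (1 / 2 : ℝ) ^ (j + M) * ((j + M + Λ).choose Λ : ℝ) := fun j => by positivity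
  have hrat : ∀ j : ℕ, (1 / 2 : ℝ) ^ (j + 1 + M) * ((j + 1 + M + Λ).choose Λ : ℝ) ≤
      r * ((1 / 2 : ℝ) ^ (j + M) * ((j + M + Λ).choose Λ : ℝ)) := by
    intro j
    -- `C(n+1, Λ) (n+1-Λ) = C(n, Λ) (n+1)` with `n = j+M+Λ`, `n+1-Λ = j+M+1`
    have hNat := Nat.choose_mul_succ_eq (j + M + Λ) Λ
    have hsub : j + M + Λ + 1 - Λ = j + M + 1 := by omega
    rw [hsub] at hNat
    have hR : ((j + M + Λ).choose Λ : ℝ) * ((j + M + Λ : ℕ) + 1 : ℝ) =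
        ((j + M + Λ + 1).choose Λ : ℝ) * ((j + M + 1 : ℕ) : ℝ) := by exact_mod_cast hNat
    have hidx : j + 1 + M + Λ = j + M + Λ + 1 := by omega
    rw [hidx]
    have hjM1 : (0 : ℝ) < ((j + M + 1 : ℕ) : ℝ) := by positivity
    -- express `C(n+1, Λ)` through `C(n, Λ)`
    have hC1 : ((j + M + Λ + 1).choose Λ : ℝ) =
        ((j + M + Λ).choose Λ : ℝ) * (((j + M + Λ : ℕ) : ℝ) + 1) / ((j + M + 1 : ℕ) : ℝ) := by
      rw [eq_div_iff hjM1.ne', hR]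
    rw [hC1, show j + 1 + M = (j + M) + 1 by ring, pow_succ]
    have hCn : (0 : ℝ) ≤ ((j + M + Λ).choose Λ : ℝ) := Nat.cast_nonneg _
    have hP : (0 : ℝ) ≤ (1 / 2 : ℝ) ^ (j + M) := by positivity
    -- the ratio `(n+1)/(2(j+M+1)) ≤ r`
    have hratio : (1 / 2 : ℝ) * ((((j + M + Λ : ℕ) : ℝ) + 1) / ((j + M + 1 : ℕ) : ℝ)) ≤ r := by
      rw [hr, mul_div_assoc', div_le_div_iff₀ (by positivity) (by positivity)]
      push_cast
      have hj : (0 : ℝ) ≤ j := Nat.cast_nonneg j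
      have hΛ0 : (0 : ℝ) ≤ Λ := Nat.cast_nonneg Λ
      nlinarith [mul_nonneg hj hΛ0]
    calc (1 / 2 : ℝ) ^ (j + M) * (1 / 2) * (((j + M + Λ).choose Λ : ℝ) * (((j + M + Λ : ℕ) : ℝ) + 1) / ((j + M + 1 : ℕ) : ℝ))
        = ((1 / 2 : ℝ) * ((((j + M + Λ : ℕ) : ℝ) + 1) / ((j + M + 1 : ℕ) : ℝ))) *
            ((1 / 2 : ℝ) ^ (j + M) * ((j + M + Λ).choose Λ : ℝ)) := by ring
      _ ≤ r * ((1 / 2 : ℝ) ^ (j + M) * ((j + M + Λ).choose Λ : ℝ)) :=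
          mul_le_mul_of_nonneg_right hratio (mul_nonneg hP hCn)
  obtain ⟨hs, hle⟩ := tsum_le_of_ratio_le hr0 hr1 ht0 hrat
  refine ⟨hs, hle.trans (le_of_eq ?_)⟩
  simp only [zero_add]
  rw [tailMajor, hr]
  have hden : (M : ℝ) + 1 - Λ ≠ 0 := by linarith
  have h1r : 1 - ((M : ℝ) + 1 + Λ) / (2 * ((M : ℝ) + 1)) = ((M : ℝ) + 1 - Λ) / (2 * ((M : ℝ) + 1)) := by
    field_simp; ring
  rw [h1r]
  field_simp

/-! ### The majorant theorem -/

/-- **Tail majorant for the stress-tensor block under the table functional at `(1/2,1/2)`** (`0 ≤ s ≤ 1`, table indices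
`≤ Λ` in each coordinate, `0 < N`, `Λ < N + 3`):
`φ[F_-[g_{2,2}]] ≤ φ[F_-[Q_N(2,2)]] + (1/2)^{2s} · 2W · tailMajor Λ (N+2)`,
`tailMajor Λ (N+2) = 2^{-(N+2)} C(N+2+Λ, Λ) · 2(N+3)/(N+3-Λ)`. PROVED (termwise action of `φ` on the pair-monomial series,
`a_{m'}(0) = [m' = 0]`, `a_m(2) ≤ 1`, the pair-monomial bound, geometric domination). [cite: RattazziEtAl2008, §5.5] -/
theorem phi_block22_le_QN_add_tail (S : Finset (ℕ × ℕ)) (w : ℕ × ℕ → ℝ) {s : ℝ} (hs0 : 0 ≤ s) (hs1 : s ≤ 1)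
    {Λ : ℕ} (hΛ : ∀ p ∈ S, p.1 ≤ Λ ∧ p.2 ≤ Λ) {N : ℕ} (hN0 : 0 < N) (hN : Λ < N + 3) :
    taylorFunctional2D (1 / 2) S w (crossF s (-1) (globalBlock 2 2)) ≤
      taylorFunctional2D (1 / 2) S w (crossF s (-1) (QN N 2 2)) +
        (1 / 2 : ℝ) ^ s * (1 / 2 : ℝ) ^ s * (2 * absWeight S w) * tailMajor Λ (N + 2) := by
  have hφ := isTaylorFunctional_taylorFunctional2D (1 / 2) S w
  have hx0 : (0 : ℝ) < 1 / 2 := by norm_num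
  have hx1 : (1 / 2 : ℝ) < 1 := by norm_num
  have hΔ : ((2 : ℕ) : ℝ) ≤ (2 : ℝ) := by norm_num
  have hρ0 : (0 : ℝ) < 1 / 2 * (1 - 1 / 2) / 2 := by norm_num
  have hρ : (1 / 2 : ℝ) * (1 - 1 / 2) / 2 < 1 / 2 * (1 - 1 / 2) := by norm_num
  have hs := hφ.hasSum_mul_of_hasSummableGerms hρ0 (hasSummableGerms_pairPow hΔ s hx0 hx1 hρ0 hρ)
    (crossF s (-1) (globalBlock 2 2)) (fun h' k hh hk =>
      hasSum_crossF_globalBlock hΔ (mem_Ioo_of_abs_lt (hh.trans hρ)) (mem_Ioo_of_abs_lt (hk.trans hρ)))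
  have h22 : ((2 : ℝ) + ((2 : ℕ) : ℝ)) / 2 = 2 := by norm_num
  have h00 : ((2 : ℝ) - ((2 : ℕ) : ℝ)) / 2 = 0 := by norm_num
  simp only [h22, h00] at hs
  -- the family and its restriction to `m' = 0`
  set F : ℕ × ℕ → ℝ := fun mm => chiralCoeff 2 mm.1 * chiralCoeff 0 mm.2 *
    taylorFunctional2D (1 / 2) S w (crossF s (-1) (pairPow (2 + (mm.1 : ℝ)) (0 + (mm.2 : ℝ)))) with hF
  have hsF : HasSum F (taylorFunctional2D (1 / 2) S w (crossF s (-1) (globalBlock 2 2))) := hs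
  have hvan : ∀ x : ℕ × ℕ, x ∉ Set.range (fun m : ℕ => (m, 0)) → F x = 0 := by
    intro x hx
    have hx2 : x.2 ≠ 0 := fun h0 => hx ⟨x.1, Prod.ext rfl h0.symm⟩
    simp only [hF, chiralCoeff_zero_left, if_neg hx2, mul_zero, zero_mul]
  have hinj : Function.Injective (fun m : ℕ => (m, 0)) := fun a b h => (Prod.mk.inj h).1
  have hsg : HasSum (F ∘ fun m : ℕ => (m, 0)) (taylorFunctional2D (1 / 2) S w (crossF s (-1) (globalBlock 2 2))) :=
    (hinj.hasSum_iff hvan).mpr hsF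
  -- the `z`-series term `g m = a_m(2) φ[F_-[pairPow (m+2) 0]]`
  set g : ℕ → ℝ := fun m => chiralCoeff 2 m *
    taylorFunctional2D (1 / 2) S w (crossF s (-1) (pairPow ((0 : ℝ) + ((m + 2 : ℕ) : ℝ)) 0)) with hg
  have hFg : (F ∘ fun m : ℕ => (m, 0)) = g := by
    funext m
    have e1 : (2 : ℝ) + (m : ℝ) = (0 : ℝ) + ((m + 2 : ℕ) : ℝ) := by push_cast; ring
    have e2 : (0 : ℝ) + ((0 : ℕ) : ℝ) = 0 := by simp
    simp only [Function.comp, hF, hg, chiralCoeff_zero_left, e1, e2]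
    simp
  rw [hFg] at hsg
  -- (2) the kept terms are `φ[F_-[Q_N(2,2)]]`
  have hQ : ∑ m ∈ range N, g m = taylorFunctional2D (1 / 2) S w (crossF s (-1) (QN N 2 2)) := by
    have hT := TN_eq_phi_QN (taylorFunctional2D (1 / 2) S w) s N 2 2
    simp only [h22, h00] at hT
    rw [← hT]
    refine Finset.sum_congr rfl fun m _ => ?_
    rw [Finset.sum_eq_single_of_mem 0 (Finset.mem_range.mpr hN0)]
    · have e1 : (2 : ℝ) + (m : ℝ) = (0 : ℝ) + ((m + 2 : ℕ) : ℝ) := by push_cast; ring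
      have e2 : (0 : ℝ) + ((0 : ℕ) : ℝ) = 0 := by simp
      simp only [hg, chiralCoeff_zero_left, e1, e2]
      simp
    · intro m' _ hm'
      rw [chiralCoeff_zero_left, if_neg hm', mul_zero, zero_mul]
  -- (3) the tail as a series
  have htail : HasSum (fun j : ℕ => g (j + N))
      (taylorFunctional2D (1 / 2) S w (crossF s (-1) (globalBlock 2 2)) -
        taylorFunctional2D (1 / 2) S w (crossF s (-1) (QN N 2 2))) := by
    rw [← hQ]
    exact (hasSum_nat_add_iff' N).mpr hsg
  -- (4) termwise bound of the tail by the majorant terms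
  set C0 : ℝ := (1 / 2 : ℝ) ^ s * (1 / 2 : ℝ) ^ s with hC0
  have hC0nn : 0 ≤ C0 := by rw [hC0]; positivity
  have hW := absWeight_nonneg S w
  have hbound : ∀ j : ℕ, g (j + N) ≤ C0 * (2 * absWeight S w) *
      ((1 / 2 : ℝ) ^ (j + (N + 2)) * ((j + (N + 2) + Λ).choose Λ : ℝ)) := by
    intro j
    have ha0 : 0 ≤ chiralCoeff 2 (j + N) := chiralCoeff_nonneg (by norm_num) _
    have ha1 : chiralCoeff 2 (j + N) ≤ 1 := chiralCoeff_two_le_one _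
    have hv := abs_taylorFunctional2D_half_pairPow_le S w hs0 hs1 hΛ (j + N + 2)
    have hidx : j + N + 2 + Λ = j + (N + 2) + Λ := by ring
    have hidx2 : (1 / 2 : ℝ) ^ (j + N + 2) = (1 / 2 : ℝ) ^ (j + (N + 2)) := by rw [add_assoc]
    rw [hidx, hidx2] at hv
    have hle := (le_abs_self _).trans hv
    calc g (j + N) = chiralCoeff 2 (j + N) *
          taylorFunctional2D (1 / 2) S w (crossF s (-1) (pairPow ((0 : ℝ) + ((j + N + 2 : ℕ) : ℝ)) 0)) := by
            simp only [hg]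
      _ ≤ chiralCoeff 2 (j + N) * ((1 / 2 : ℝ) ^ s * (1 / 2 : ℝ) ^ s * (1 / 2 : ℝ) ^ (j + (N + 2)) *
            (2 * ((j + (N + 2) + Λ).choose Λ : ℝ) * absWeight S w)) := mul_le_mul_of_nonneg_left hle ha0
      _ ≤ 1 * ((1 / 2 : ℝ) ^ s * (1 / 2 : ℝ) ^ s * (1 / 2 : ℝ) ^ (j + (N + 2)) *
            (2 * ((j + (N + 2) + Λ).choose Λ : ℝ) * absWeight S w)) :=
          mul_le_mul_of_nonneg_right ha1 (by positivity)
      _ = C0 * (2 * absWeight S w) * ((1 / 2 : ℝ) ^ (j + (N + 2)) * ((j + (N + 2) + Λ).choose Λ : ℝ)) := by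
          rw [hC0]; ring
  -- (5) the majorant series is geometric
  obtain ⟨hsum, hmaj⟩ := tsum_tail_le_tailMajor (Λ := Λ) (M := N + 2) (by omega)
  have hsumB : Summable fun j : ℕ => C0 * (2 * absWeight S w) *
      ((1 / 2 : ℝ) ^ (j + (N + 2)) * ((j + (N + 2) + Λ).choose Λ : ℝ)) := hsum.mul_left _
  have hcmp := hasSum_le hbound htail hsumB.hasSum
  rw [tsum_mul_left] at hcmp
  have hfin : C0 * (2 * absWeight S w) * ∑' j : ℕ, (1 / 2 : ℝ) ^ (j + (N + 2)) * ((j + (N + 2) + Λ).choose Λ : ℝ) ≤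
      C0 * (2 * absWeight S w) * tailMajor Λ (N + 2) :=
    mul_le_mul_of_nonneg_left hmaj (by positivity)
  linarith

/-! ### Kind `ope2`, sense lower, from the cells record -/

/-- **The cells of a kind-`ope2` certificate** for the table functional at `Δ_σ = s` under `A2D′`: `BoxCellsN` WITHOUT the
stress-tensor point — for kind `ope2` the `(2,2)` block is the TARGET (its sign is a separate obligation), not a positivity row:
(E) `ℓ = 0` on `[e₁, e₂]`, (C′) `ℓ = 0` on `[G, E₀)`, `ℓ = 2` on `[2+δ, E₀)`, even `ℓ ≥ 4` on `[ℓ, E₀)`, each with its own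
truncation witness. [cite: RattazziEtAl2008, §5.5] -/
def OpeCellsN (S : Finset (ℕ × ℕ)) (w : ℕ × ℕ → ℝ) (s G δ e₁ e₂ E₀ : ℝ) : Prop :=
  (∀ Δ : ℝ, e₁ ≤ Δ → Δ ≤ e₂ → ∃ N : ℕ, E₀ ≤ N ∧
      0 ≤ taylorFunctional2D (1 / 2) S w (crossF s (-1) (QN N 0 Δ))) ∧
  (∀ Δ : ℝ, G ≤ Δ → Δ < E₀ → ∃ N : ℕ, E₀ ≤ N ∧
      0 ≤ taylorFunctional2D (1 / 2) S w (crossF s (-1) (QN N 0 Δ))) ∧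
  (∀ Δ : ℝ, 2 + δ ≤ Δ → Δ < E₀ → ∃ N : ℕ, E₀ ≤ N ∧
      0 ≤ taylorFunctional2D (1 / 2) S w (crossF s (-1) (QN N 2 Δ))) ∧
  (∀ ℓ : ℕ, Even ℓ → ℓ ≠ 0 → ℓ ≠ 2 → ∀ Δ : ℝ, (ℓ : ℝ) ≤ Δ → Δ < E₀ → ∃ N : ℕ, E₀ ≤ N ∧
      0 ≤ taylorFunctional2D (1 / 2) S w (crossF s (-1) (QN N ℓ Δ)))

/-- A kind-`box` cells record contains the kind-`ope2` one. [folklore] -/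
theorem BoxCellsN.opeCellsN {S : Finset (ℕ × ℕ)} {w : ℕ × ℕ → ℝ} {s G δ e₁ e₂ E₀ : ℝ}
    (h : BoxCellsN S w s G δ e₁ e₂ E₀) : OpeCellsN S w s G δ e₁ e₂ E₀ :=
  ⟨h.1, h.2.1, h.2.2.2.1, h.2.2.2.2⟩


/-- **Kind `ope2`, sense LOWER, at `(1/2,1/2)` from the cells record** (`0 ≤ s < 1`, `2s < e₁`, `2s < G`, `δ ≥ 0`,
`P ≥ 0`, table indices `≤ Λ`, `0 < N_T`, `Λ < N_T + 3`, `N_T + 2 ≥ E₀`): (I′) checked on the truncated `(2,2)` block `Q_{N_T}`,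
the SIGN CHECK `φ[F_-[Q_{N_T}(2,2)]] + (1/2)^{2s}·2W·tailMajor Λ (N_T+2) < 0`, the region inequality (R) and the kind-`ope2`
cells record (`OpeCellsN`: no stress-tensor row) give `OpeLowerA2D s G δ e₁ e₂ P` (`P < p_T`). PROVED (`phi_QN_le_block_taylor` lifts (I′) since `P ≥ 0`;
`phi_block22_le_QN_add_tail` gives `φ[F_-[g_{2,2}]] < 0`; cells as in `opeUpper_half_of_cellsN`; then
`OpeA2DObligations.opeLower_taylor`). [cite: RattazziEtAl2008, §5] -/
theorem opeLower_half_of_cellsN (S : Finset (ℕ × ℕ)) (w : ℕ × ℕ → ℝ) {s G δ e₁ e₂ P E₀ : ℝ} {Λ NT : ℕ}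
    (hs0 : 0 ≤ s) (hs1 : s < 1) (he : 2 * s < e₁) (hG : 2 * s < G) (hδ : 0 ≤ δ) (hP : 0 ≤ P)
    (hNT : E₀ ≤ 2 + NT) (hΛ : ∀ p ∈ S, p.1 ≤ Λ ∧ p.2 ≤ Λ) (hN0 : 0 < NT) (hΛN : Λ < NT + 3)
    (hI' : 0 < taylorFunctional2D (1 / 2) S w (crossF s (-1) (fun _ _ => (1 : ℝ))) +
      P * taylorFunctional2D (1 / 2) S w (crossF s (-1) (QN NT 2 2)))
    (hT : taylorFunctional2D (1 / 2) S w (crossF s (-1) (QN NT 2 2)) +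
      (1 / 2 : ℝ) ^ s * (1 / 2 : ℝ) ^ s * (2 * absWeight S w) * tailMajor Λ (NT + 2) < 0)
    (hR : ∀ (b : ℝ) (J : ℕ), 0 ≤ b → E₀ ≤ 2 * b + J →
      0 ≤ ∑ p ∈ S, w p * ((1 - (-1 : ℝ) ^ (p.1 + p.2)) * 2 ^ (p.1 + p.2) *
        (qFactor₁ s (b + J) p.1 * qFactor₁ s b p.2 + qFactor₁ s b p.1 * qFactor₁ s (b + J) p.2)))
    (hc : OpeCellsN S w s G δ e₁ e₂ E₀) : OpeLowerA2D s G δ e₁ e₂ P := by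
  have hφ := isTaylorFunctional_taylorFunctional2D (1 / 2) S w
  have hx0 : (0 : ℝ) < 1 / 2 := by norm_num
  have hx1 : (1 / 2 : ℝ) < 1 := by norm_num
  have hpair : PairPositiveAbove (taylorFunctional2D (1 / 2) S w) s E₀ :=
    pairPositiveAbove_half_of_poly S w hR
  have hcell : ∀ (ℓ : ℕ) (Δ : ℝ), (ℓ : ℝ) ≤ Δ →
      (∃ N : ℕ, E₀ ≤ N ∧ 0 ≤ taylorFunctional2D (1 / 2) S w (crossF s (-1) (QN N ℓ Δ))) →
      BlockPositive (taylorFunctional2D (1 / 2) S w) s Δ ℓ := by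
    intro ℓ Δ hℓΔ hQ
    rcases le_or_gt E₀ Δ with hge | hlt
    · exact high_nonneg_of_pairPositive_taylor hφ hx0 hx1 hpair ℓ Δ hℓΔ hge
    · obtain ⟨N, hN, h⟩ := hQ
      have : (0 : ℝ) ≤ ℓ := Nat.cast_nonneg ℓ
      exact blockPositive_of_QN_nonneg_taylor hφ hx0 hx1 hpair (N := N) hℓΔ (by linarith) h
  -- the truncated `(2,2)` block under-estimates the full one ((I′) lifts) and the majorant bounds it from above (sign)
  have hTle : taylorFunctional2D (1 / 2) S w (crossF s (-1) (QN NT 2 2)) ≤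
      taylorFunctional2D (1 / 2) S w (crossF s (-1) (globalBlock 2 2)) :=
    phi_QN_le_block_taylor hφ hx0 hx1 hpair (Δ := 2) (ℓ := 2) (N := NT) (by norm_num) (by linarith)
  have hTge := phi_block22_le_QN_add_tail S w hs0 hs1.le hΛ hN0 hΛN
  have hX : taylorFunctional2D (1 / 2) S w (crossF s (-1) (globalBlock 2 2)) < 0 := lt_of_le_of_lt hTge hT
  have hob : OpeA2DObligations (taylorFunctional2D (1 / 2) S w) s G δ e₁ e₂ P E₀ := by
    refine ⟨?_, ?_, ?_, ?_, ?_, ?_⟩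
    · have hmul : P * taylorFunctional2D (1 / 2) S w (crossF s (-1) (QN NT 2 2)) ≤
          P * taylorFunctional2D (1 / 2) S w (crossF s (-1) (globalBlock 2 2)) :=
        mul_le_mul_of_nonneg_left hTle hP
      linarith
    · intro Δ h1 h2
      exact hcell 0 Δ (by simp only [Nat.cast_zero]; linarith) (hc.1 Δ h1 h2)
    · intro Δ h1 h2
      exact hcell 0 Δ (by simp only [Nat.cast_zero]; linarith) (hc.2.1 Δ h1 h2)
    · intro Δ h1 h2
      exact hcell 2 Δ (by push_cast; linarith) (hc.2.2.1 Δ h1 h2)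
    · intro ℓ hℓ hℓ0 hℓ2 Δ hℓΔ hΔE
      exact hcell ℓ Δ hℓΔ (hc.2.2.2 ℓ hℓ hℓ0 hℓ2 Δ hℓΔ hΔE)
    · exact fun ℓ _ Δ hℓΔ hge => high_nonneg_of_pairPositive_taylor hφ hx0 hx1 hpair ℓ Δ hℓΔ hge
  exact OpeA2DObligations.opeLower_taylor hφ hx0 hx1 he hG hs1 hob hX

end Summit.CriticalPhenomena.Ising3D.Control2D
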